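import Summits.SmoothPoincare4.SmoothPoincare4.Theorems.EntropyRungMargerinRailsDefs
import Summits.SmoothPoincare4.SmoothPoincare4.Theorems.EntropyRungChangGurskyYangStubInitialFit
import Literature.Geometry.Riemannian.ChangGurskyYangProofs
import HarnessLib

/-!
# Route EntropyRung · crux `ChangGurskyYang` · line `margerin-cone-hamilton-rails` — STUB 4b
# `stub_invariantPinching` (the pinching set in invariant form)

Stub `stub_invariantPinching` of the registered skeleton
`Cruxes/ChangGurskyYang/Lines/margerin-cone-hamilton-rails.lean` of crux stmt-SmoothPoincare4-10834
(`Summit.SmoothPoincare4.SmoothPoincare4.Theses.EntropyRung.ChangGurskyYang`), over the vocabulary of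
`Theorems/EntropyRungMargerinRailsDefs.lean` (`scal`, `devNormSq`, `margerinCone`, `pinchingSet`) and
the dictionary of `Theorems/EntropyRungChangGurskyYangStubInitialFit.lean`
(`blocks_eq_leviCivita_of_isLeviCivita`, `scal_blocks_eq`, `devNormSq_blocks_eq`).

Mathematics (Margerin 1998, Part I, p. 25; Chang–Gursky–Yang 2003, (0.2)): the pinching set
`pinchingSet m c K τ = margerinCone c ∩ {R ≥ m} ∩ {|𝒟|² ≤ K R^{2−τ}}` is a condition on Hamilton's
blocks `(A, B, C)` of the curvature operator in an orthonormal frame; in such a frame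
`scal (A, B, C) = tr A + tr C = R(x)` and Margerin's deviation is
`|𝒟|² = ‖A‖² + 2‖B‖² + ‖C‖² − R²/6 = |W|²(x) + 2|E|²(x)` (CGY's `|Z|² = |W|² + 2|E|²`), the frame sums
`Σ W_{ijkl}²`, `Σ E_{ab}²` being the frame-free pointwise norms `weylNormSq`, `tracelessRicciNormSq`
on a `4`-dimensional model. Hence membership of the blocks in `pinchingSet m c K τ` in every orthonormal
frame (one exists at every point of a Riemannian manifold) gives pointwise `m ≤ R(x)` and
`|W|²(x) + 2|E|²(x) ≤ K R(x)^{2−τ}`; the cone face `WP ≤ c` is not used.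

References: C. Margerin, Comm. Anal. Geom. 6 (1998) 21–65, Part I, p. 25 [Margerin1998];
S.-Y. A. Chang, M. J. Gursky, P. C. Yang, Publ. Math. IHÉS 98 (2003) 105–143, (0.2) and Remark 2
[ChangGurskyYang2003]; R. S. Hamilton, J. Differential Geom. 24 (1986) 153–179, §6–§7
[Hamilton1986].
-/

noncomputable section

-- every `Summit.SmoothPoincare4.SmoothPoincare4.…` name repeats the summit = sub-problem segment (D-0017 layout)
set_option linter.dupNamespace false

open Set Function Module
open scoped Manifold ContDiff Matrix BigOperators Topology

namespace Summit.SmoothPoincare4.SmoothPoincare4.Theorems.MargerinRails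

open Literature.Geometry.Riemannian Literature.Geometry.Riemannian.HamiltonODE
open Literature.Geometry.Lorentzian Literature.Geometry.Lorentzian.PseudoRiemannianMetric

/-! ## STUB 4b of the line: the pinching set in invariant form -/

/-- **STUB 4b — THE PINCHING SET IN INVARIANT FORM (dictionary).** If the Hamilton blocks of a
Levi-Civita connection of a `C^∞` Riemannian metric on a 4-manifold lie in `pinchingSet m c K τ` in every
orthonormal frame, then pointwise `m ≤ R` and `|W|² + 2|E|² ≤ K R^{2−τ}`: at each point pick an
orthonormal frame (`exists_basis_isOrthonormalFrame`), pass to `g.leviCivita`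
(`blocks_eq_leviCivita_of_isLeviCivita`), and read `tr A + tr C = R` (`scal_blocks_eq`),
`|𝒟|² = Σ W² + 2 Σ E²` (`devNormSq_blocks_eq`) with `|W|²`, `|E|²` the frame values
(`weylNormSq_eq_weylNormSqFrame_four`, `tracelessRicciNormSq_eq_tracelessRicciNormSqFrame_four`). The
cone face `WP ≤ c` is not needed and is dropped.
[cite: Margerin1998, Part I, p. 25] [cite: ChangGurskyYang2003, (0.2)] -/
theorem stub_invariantPinching :
    ∀ (M : Type) [TopologicalSpace M] [T2Space M] [SecondCountableTopology M]
      [ChartedSpace (EuclideanSpace ℝ (Fin 4)) M] [IsManifold (𝓡 4) ∞ M]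
      (g : PseudoRiemannianMetric (𝓡 4) ∞ (EuclideanSpace ℝ (Fin 4)) (TangentSpace (𝓡 4) : M → Type _))
      [g.HasLeviCivita]
      (cov : CovariantDerivative (𝓡 4) (EuclideanSpace ℝ (Fin 4)) (TangentSpace (𝓡 4) : M → Type _))
      (m c K τ : ℝ), g.IsRiemannian → g.IsLeviCivita cov →
      (∀ (x : M) (e : Fin 4 → TangentSpace (𝓡 4) x), g.IsOrthonormalFrame x e →
        (g.blockA cov x e, g.blockB cov x e, g.blockC cov x e) ∈ pinchingSet m c K τ) →
      ∀ x : M, m ≤ g.scalarCurvature x ∧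
        g.weylNormSq x + 2 * g.tracelessRicciNormSq x ≤ K * g.scalarCurvature x ^ (2 - τ) := by
  intro M _ _ _ _ _ g _ cov m c K τ hg hcov hpinch x
  have hn : (2 : ℕ∞ω) ≤ ∞ := WithTop.coe_le_coe.mpr le_top
  have hE : finrank ℝ (EuclideanSpace ℝ (Fin 4)) = 4 := finrank_euclideanSpace_fin
  -- an orthonormal frame at `x`
  obtain ⟨b, hb⟩ := g.exists_basis_isOrthonormalFrame (x := x) (hg x) hE
  -- the hypothesis in that frame, transported to the canonical Levi-Civita connection
  have hmem := hpinch x b hb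
  rw [blocks_eq_leviCivita_of_isLeviCivita hcov hn x b, mem_pinchingSet] at hmem
  obtain ⟨-, hscal_le, hdev_le⟩ := hmem
  -- the dictionary: `scal = R(x)`, `|𝒟|² = Σ W² + 2 Σ E² = |W|² + 2|E|²`
  rw [scal_blocks_eq g hn hE hb] at hscal_le hdev_le
  rw [devNormSq_blocks_eq g hn hE hb, ← g.weylNormSq_eq_weylNormSqFrame_four hE hb,
    ← g.tracelessRicciNormSq_eq_tracelessRicciNormSqFrame_four hE hb] at hdev_le
  exact ⟨hscal_le, hdev_le⟩

end Summit.SmoothPoincare4.SmoothPoincare4.Theorems.MargerinRails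

end
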